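import Literature.NumberTheory.EllipticCurves.WeierstrassGeometricOrders
import Literature.NumberTheory.EllipticCurves.LangArtinSchreierCover
import Literature.NumberTheory.DiophantineGeometry.FunctionFieldFrobenius
import HarnessLib

/-!
# The Lang torsor over `k̄`: values of `λ x`, `λ y` at geometric points, places, Frobenius

Topic `NumberTheory/EllipticCurves`. For an elliptic curve `W` over a finite field `k` with
`q` elements, `K = k(W)`, `λ = lam W : K → K` the Lang–Manin embedding `h ↦ h(P₀ - Q)`
(`LangTorsor`, `LangTorsorFrobenius`: `P₀ = (x^q, y^q)`, `Q = (x, y)`), and `ι : K → k̄(W)`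
(`WeierstrassGeometricPlaces.toGeom`), this file computes the maps `ϖ = φ - 1 : E → E` behind `λ`
on geometric points:

* `hasValueAt_toGeom_lam` (**values**): at a geometric point `P` with `σP ≠ P` (`σ` the arithmetic
  Frobenius), `ι(λ x)` and `ι(λ y)` take the values `x(σP - P)`, `y(σP - P)`; proved with an
  auxiliary generic constant point `B ∈ E(k̄)` (`P₀ - Q = (P₀ + B) - (Q + B)`), so that the chord
  through the values is never degenerate;
* (continued in later sections: places below `σP - P` versus `λ`, poles at `k`-points, Frobenius
  elements of the Lang covering, unramifiedness, the reciprocity `Σ_v ord_v(h) T_v = O`).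

Everything is proved; no named facts.

## References

* S. Lang, *Abelian varieties over finite fields*, 1955/56; J.-P. Serre, *Algebraic Groups and Class
  Fields*, GTM 117, VI.§6 (the Lang isogeny `φ - 1`). [cited through SilvermanAEC2009]
* J. H. Silverman, *The Arithmetic of Elliptic Curves*, 2nd ed., GTM 106, II.§2, III.§2–§3. [SilvermanAEC2009]
* D. R. Kohel, I. E. Shparlinski, *On exponential sums and group generators for elliptic curves over
  finite fields*, ANTS-IV, LNCS 1838 (2000), 395–404, §2. [KohelShparlinski2000]
-/

noncomputable section

open scoped Classical Polynomial.Bivariate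
open Polynomial WeierstrassCurve WeierstrassCurve.Affine WeierstrassCurve.geomPoints
open Literature.NumberTheory.EllipticCurves.WeierstrassFunctionField
open Literature.NumberTheory.EllipticCurves.HasseManin
open Literature.NumberTheory.EllipticCurves.LangTorsor
open Literature.NumberTheory.DiophantineGeometry Literature.NumberTheory.DiophantineGeometry.AlgFunctionField
open Literature.NumberTheory.EllipticCurves.WeierstrassGeometricPlaces
open Literature.NumberTheory.EllipticCurves.WeierstrassGeometricOrders

universe u

namespace Literature.NumberTheory.EllipticCurves.LangTorsorGeometric

variable {F : Type u} [Field F] (W : WeierstrassCurve F)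

/-- `E(k) → E(k̄)` is additive (classical decidability on `k`, as in the tree's `toGeomPoints`). [folklore] -/
theorem toGeomPoints_add_classical (T T' : W.toAffine.Point) :
    W.toGeomPoints (T + T') = W.toGeomPoints T + W.toGeomPoints T' :=
  map_add _ _ _

variable [Fintype F] [DecidableEq F] [W.IsElliptic]

/-! ### The `q`-Frobenius of `k̄(W)` and the points `ι(Q)`, `ι(P₀)` -/

section Frobenius

/-- **The `q`-power Frobenius of `k̄(W)`**, `z ↦ z^q`, a `k`-algebra endomorphism (not `k̄`-linear).
[cite: SilvermanAEC2009, II.§2] -/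
def geomFrob : W.geomFunctionField →ₐ[F] W.geomFunctionField := FiniteField.frobeniusAlgHom F _

omit [W.IsElliptic] [DecidableEq F] in
/-- `geomFrob z = z^q`. [folklore] -/
theorem geomFrob_apply (z : W.geomFunctionField) : geomFrob W z = z ^ Fintype.card F := rfl

omit [W.IsElliptic] [DecidableEq F] in
/-- `geomFrob ∘ ι = ι ∘ frob`. [folklore] -/
theorem geomFrob_toGeom (z : W.toAffine.FunctionField) : geomFrob W (toGeom W z) = toGeom W (frob W z) := by
  rw [geomFrob_apply, frob_apply, map_pow]

omit [Fintype F] [W.IsElliptic] [DecidableEq F] in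
/-- Two affine points with equal coordinates are equal. [folklore] -/
theorem some_eq_some {L : Type*} [Field L] [Algebra F L] {x₁ y₁ x₂ y₂ : L}
    {h₁ : (W.baseChange L).toAffine.Nonsingular x₁ y₁} {h₂ : (W.baseChange L).toAffine.Nonsingular x₂ y₂}
    (hx : x₁ = x₂) (hy : y₁ = y₂) : Affine.Point.some x₁ y₁ h₁ = Affine.Point.some x₂ y₂ h₂ := by
  subst hx hy; rfl

omit [Fintype F] [DecidableEq F] in
/-- **`ι(Q)` is the generic point of `E(k̄(W))`.** [folklore] -/
theorem map_toGeom_genPt : Affine.Point.map (W' := W) (toGeom W) (genPt W) = W.genericPoint := by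
  rw [genPt_eq, Affine.Point.map_some, WeierstrassCurve.genericPoint]
  exact some_eq_some W (toGeom_xF W) (toGeom_yF W)

omit [Fintype F] [W.IsElliptic] [DecidableEq F] in
/-- `ι t = x`. [folklore] -/
theorem toGeom_gT : toGeom W (gT W) = W.genX := toGeom_xF W

omit [Fintype F] [W.IsElliptic] [DecidableEq F] in
/-- `ι s = y`. [folklore] -/
theorem toGeom_gS : toGeom W (gS W) = W.genY := toGeom_yF W

omit [DecidableEq F] in
/-- **`ι(P₀)` is the Frobenius twist of the generic point.** [folklore] -/
theorem map_toGeom_frobPt :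
    Affine.Point.map (W' := W) (toGeom W) (frobPt W) = Affine.Point.map (W' := W) (geomFrob W) W.genericPoint := by
  rw [frobPt_eq, Affine.Point.map_some, WeierstrassCurve.genericPoint, Affine.Point.map_some]
  refine some_eq_some W ?_ ?_
  · rw [map_pow, toGeom_gT, geomFrob_apply]
  · rw [map_pow, toGeom_gS, geomFrob_apply]

variable (σ : Field.absoluteGaloisGroup F) (hσ : ∀ x : AlgebraicClosure F, σ • x = x ^ Fintype.card F)

omit [W.IsElliptic] [DecidableEq F] in
include hσ in
/-- **`geomFrob` on constant points is `σ`**: `Frob(B) = σ B` for `B ∈ E(k̄)`. [folklore] -/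
theorem map_geomFrob_constPoint (b : W.geomPoints) :
    Affine.Point.map (W' := W) (geomFrob W) (W.constPoint b) = W.constPoint (σ • b) := by
  rcases eq_or_ne b 0 with rfl | hb
  · rw [smul_zero, map_zero, map_zero]
  obtain ⟨a, c, h, rfl⟩ := geomPoints.exists_eq_some hb
  obtain ⟨h', e⟩ := smul_some_eq W σ h
  rw [e, constPoint_some, constPoint_some, Affine.Point.map_some]
  refine some_eq_some W ?_ ?_
  · rw [geomFrob_apply, ← map_pow, ← hσ]
  · rw [geomFrob_apply, ← map_pow, ← hσ]

end Frobenius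

/-! ### Values of `ι(λ x)`, `ι(λ y)` at geometric points -/

section Values

variable (σ : Field.absoluteGaloisGroup F) (hσ : ∀ x : AlgebraicClosure F, σ • x = x ^ Fintype.card F)

omit [Fintype F] [W.IsElliptic] [DecidableEq F] in
/-- Two affine points of `E(k̄)` with the same `x`-coordinate are equal or opposite. [folklore] -/
theorem eq_or_eq_neg_of_xy_zero_eq {S T : W.geomPoints} (hS : S ≠ 0) (hT : T ≠ 0) (h : xy S 0 = xy T 0) :
    S = T ∨ S = -T := by
  obtain ⟨s₁, s₂, hs, rfl⟩ := geomPoints.exists_eq_some hS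
  obtain ⟨t₁, t₂, ht, rfl⟩ := geomPoints.exists_eq_some hT
  simp only [xy_some, Matrix.cons_val_zero] at h
  by_cases hy : s₂ = (W.baseChange (AlgebraicClosure F)).toAffine.negY t₁ t₂
  · right
    rw [show -(show W.geomPoints from Affine.Point.some t₁ t₂ ht) =
      (show W.geomPoints from Affine.Point.some t₁ _ ((Affine.nonsingular_neg ..).mpr ht)) from rfl]
    exact some_eq_some W h hy
  · left
    exact some_eq_some W h (Affine.Y_eq_of_Y_ne hs.left ht.left h hy)

omit [Fintype F] [DecidableEq F] in
/-- The finite set of "bad" auxiliary points is avoidable: `E(k̄)` is infinite. [folklore] -/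
theorem exists_good_aux (P P' : W.geomPoints) :
    ∃ b : W.geomPoints, b ≠ P ∧ b ≠ -P ∧ b ≠ P' ∧ b ≠ -P' ∧ 2 • b ≠ -(P' + P) := by
  -- the doubling fibre over `-(P' + P)` is finite
  have hfin : {b : W.geomPoints | 2 • b = -(P' + P)}.Finite := by
    by_cases hex : ∃ b₀ : W.geomPoints, 2 • b₀ = -(P' + P)
    · obtain ⟨b₀, hb₀⟩ := hex
      have hsub : {b : W.geomPoints | 2 • b = -(P' + P)} ⊆ (fun t => t + b₀) '' {t : W.geomPoints | 2 • t = 0} := by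
        intro b hb
        refine ⟨b - b₀, ?_, sub_add_cancel b b₀⟩
        simp only [Set.mem_setOf_eq] at hb ⊢
        rw [smul_sub, hb, hb₀, sub_self]
      exact ((geomPoints.finite_setOf_nsmul_eq_zero (W := W) two_ne_zero).image _).subset hsub
    · push Not at hex
      convert Set.finite_empty
      ext b; simpa using hex b
  have hfin' : ({P, -P, P', -P'} ∪ {b : W.geomPoints | 2 • b = -(P' + P)}).Finite :=
    (Set.toFinite _).union hfin
  obtain ⟨b, hb⟩ := hfin'.infinite_compl.nonempty
  simp only [Set.mem_compl_iff, Set.mem_union, Set.mem_insert_iff, Set.mem_singleton_iff,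
    Set.mem_setOf_eq, not_or] at hb
  exact ⟨b, hb.1.1, hb.1.2.1, hb.1.2.2.1, hb.1.2.2.2, hb.2⟩

include hσ in
/-- **Values of `ι(λ x)` and `ι(λ y)` at geometric points**: at `P ∈ E(k̄)` with `σP ≠ P`, the
functions `ι(λ x) = x(P₀ - Q)` and `ι(λ y) = y(P₀ - Q)` take the values `x(σP - P)`, `y(σP - P)`;
that is, `λ` is the pull-back along the Lang map `ϖ = φ - 1 : R ↦ φ(R) - R` wherever `ϖ(R) ≠ O`.
Proof: for a generic constant point `B`, `P₀ - Q = (P₀ + B) - (Q + B)` in `E(k̄(W))`, the coordinates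
of `Q + B = τ_B^*(x, y)` and `P₀ + B = Frob(τ_{σ⁻¹B}^*(x, y))` have the values `(P + B)` and
`σ(P + σ⁻¹B) = σP + B` at `P`, with distinct `x`-values, so the chord formula evaluates.
[cite: SilvermanAEC2009, III.2.3 and II.§2] [cite: KohelShparlinski2000, §2] -/
theorem hasValueAt_toGeom_lam {P : W.geomPoints} (hP : P ≠ 0) (hσP : σ • P ≠ P) :
    W.HasValueAt (toGeom W (lam W (gT W))) P (xy (σ • P - P) 0) ∧
      W.HasValueAt (toGeom W (lam W (gS W))) P (xy (σ • P - P) 1) := by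
  -- an auxiliary constant point avoiding the degenerate configurations
  obtain ⟨b, hbP, hbP', hbσ, hbσ', hb2⟩ := exists_good_aux W P (σ • P)
  set b' : W.geomPoints := σ⁻¹ • b with hb'
  have hbb' : σ • b' = b := smul_inv_smul σ b
  have hPb' : P ≠ b' := fun h => hbσ (by rw [← hbb', ← h])
  have hPb'0 : P + b' ≠ 0 := fun h => hbσ' (by
    have := congrArg (σ • ·) h
    simp only [smul_add, hbb', smul_zero] at this
    rw [← sub_eq_zero, sub_neg_eq_add, add_comm]; exact this)
  have hPb0 : P + b ≠ 0 := fun h => hbP' (by rw [← sub_eq_zero, sub_neg_eq_add, add_comm]; exact h)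
  -- the two value points `S = σP + B`, `T = P + B`
  set S : W.geomPoints := σ • P + b with hSdef
  set T : W.geomPoints := P + b with hTdef
  have hS0 : S ≠ 0 := fun h => hbσ' (by rw [← sub_eq_zero, sub_neg_eq_add, add_comm]; exact h)
  have hT0 : T ≠ 0 := hPb0
  have hST : S ≠ T := fun h => hσP (add_right_cancel h)
  have hST' : S ≠ -T := fun h => hb2 (by
    have h2 : σ • P + b + (P + b) = 0 := by rw [← hSdef, h, hTdef]; exact neg_add_cancel _
    have e : (2 : ℕ) • b = (σ • P + b + (P + b)) - (σ • P + P) := by rw [two_smul]; abel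
    rw [e, h2, zero_sub])
  obtain ⟨s₁, s₂, hs, hSe⟩ := geomPoints.exists_eq_some hS0
  obtain ⟨t₁, t₂, ht, hTe⟩ := geomPoints.exists_eq_some hT0
  have hx : s₁ ≠ t₁ := by
    intro h
    rcases eq_or_eq_neg_of_xy_zero_eq W hS0 hT0 (by rw [hSe, hTe, xy_some, xy_some]; simpa using h) with h' | h'
    · exact hST h'
    · exact hST' h'
  -- values of the coordinates of `Q + B = τ_B^* (x, y)` : `(t₁, t₂)`
  have hv₁ : W.HasValueAt (W.transAlgHom b W.genX) P t₁ := by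
    have := hasValueAt_transAlgHom_gen hP hbP.symm hPb0 0
    rw [← hTdef, hTe, xy_some] at this; simpa using this
  have hv₂ : W.HasValueAt (W.transAlgHom b W.genY) P t₂ := by
    have := hasValueAt_transAlgHom_gen hP hbP.symm hPb0 1
    rw [← hTdef, hTe, xy_some] at this; simpa using this
  -- values of the coordinates of `P₀ + B = Frob (τ_{B'}^* (x, y))` : `(s₁, s₂)`
  have hSsmul : σ • (P + b') = S := by rw [smul_add, hbb']
  have hu₁ : W.HasValueAt (geomFrob W (W.transAlgHom b' W.genX)) P s₁ := by
    have h0 := (hasValueAt_transAlgHom_gen hP hPb' hPb'0 0).pow (Fintype.card F)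
    rw [← hσ] at h0
    have e : σ • xy (P + b') 0 = s₁ := by
      have := congrFun (xy_smul σ (P + b')) 0
      rw [hSsmul, hSe, xy_some] at this
      rw [← galRingHom_apply]
      simpa using this.symm
    rw [e] at h0; simpa [geomFrob_apply] using h0
  have hu₂ : W.HasValueAt (geomFrob W (W.transAlgHom b' W.genY)) P s₂ := by
    have h0 := (hasValueAt_transAlgHom_gen hP hPb' hPb'0 1).pow (Fintype.card F)
    rw [← hσ] at h0
    have e : σ • xy (P + b') 1 = s₂ := by
      have := congrFun (xy_smul σ (P + b')) 1
      rw [hSsmul, hSe, xy_some] at this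
      rw [← galRingHom_apply]
      simpa using this.symm
    rw [e] at h0; simpa [geomFrob_apply] using h0
  -- the functions `u₁ ≠ v₁`
  set u₁ := geomFrob W (W.transAlgHom b' W.genX) with hu₁def
  set u₂ := geomFrob W (W.transAlgHom b' W.genY) with hu₂def
  set v₁ := W.transAlgHom b W.genX with hv₁def
  set v₂ := W.transAlgHom b W.genY with hv₂def
  have huv : u₁ ≠ v₁ := fun h => hx (hu₁.unique hP (h ▸ hv₁))
  -- the points `U = P₀ + B`, `V = Q + B` of `E(k̄(W))`
  have hU : Affine.Point.map (W' := W) (geomFrob W) W.genericPoint + W.constPoint b =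
      Affine.Point.map (W' := W) (geomFrob W) (Affine.Point.map (W' := W) (W.transAlgHom b') W.genericPoint) := by
    rw [map_transAlgHom_genericPoint, map_add, map_geomFrob_constPoint W σ hσ b', hbb']
  have hV : W.genericPoint + W.constPoint b = Affine.Point.map (W' := W) (W.transAlgHom b) W.genericPoint :=
    (map_transAlgHom_genericPoint b).symm
  obtain ⟨hUns, hUe⟩ : ∃ hU' : (W.baseChange W.geomFunctionField).toAffine.Nonsingular u₁ u₂,
      Affine.Point.map (W' := W) (geomFrob W) (Affine.Point.map (W' := W) (W.transAlgHom b') W.genericPoint) =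
        .some u₁ u₂ hU' := by
    rw [WeierstrassCurve.genericPoint, Affine.Point.map_some, Affine.Point.map_some]
    exact ⟨_, rfl⟩
  obtain ⟨hVns, hVe⟩ : ∃ hV' : (W.baseChange W.geomFunctionField).toAffine.Nonsingular v₁ v₂,
      Affine.Point.map (W' := W) (W.transAlgHom b) W.genericPoint = .some v₁ v₂ hV' := by
    rw [WeierstrassCurve.genericPoint, Affine.Point.map_some]
    exact ⟨_, rfl⟩
  -- `ι(P₀ - Q) = U - V`, computed by the chord formula
  have hlam : Affine.Point.map (W' := W) (toGeom W) (Affine.Point.map (W' := W) (lam W) (genPt W)) =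
      .some u₁ u₂ hUns - .some v₁ v₂ hVns := by
    rw [map_lam_genPt, map_sub, map_toGeom_frobPt, map_toGeom_genPt, ← hUe, ← hVe, ← hU, ← hV,
      add_sub_add_right_eq_sub]
  rw [sub_eq_add_neg, Affine.Point.neg_some, Affine.Point.add_of_X_ne huv, genPt_eq, Affine.Point.map_some,
    Affine.Point.map_some] at hlam
  obtain ⟨hlx, hly⟩ := Affine.Point.some.inj hlam
  -- the same chord over `k̄`: `σP - P = S - T`
  have hdiff : σ • P - P = S - T := by rw [hSdef, hTdef, add_sub_add_right_eq_sub]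
  have hneg : -(show W.geomPoints from .some t₁ t₂ ht) =
      (show W.geomPoints from .some t₁ _ ((Affine.nonsingular_neg ..).mpr ht)) := rfl
  have hadd : (show W.geomPoints from .some s₁ s₂ hs) +
      (show W.geomPoints from .some t₁ _ ((Affine.nonsingular_neg ..).mpr ht)) =
        (show W.geomPoints from .some _ _ (Affine.nonsingular_add hs ((Affine.nonsingular_neg ..).mpr ht)
          fun hxy => hx hxy.left)) :=
    Affine.Point.add_of_X_ne hx
  have hxy : xy (σ • P - P) =
      ![(W.baseChange (AlgebraicClosure F)).toAffine.addX s₁ t₁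
          ((W.baseChange (AlgebraicClosure F)).toAffine.slope s₁ t₁ s₂
            ((W.baseChange (AlgebraicClosure F)).toAffine.negY t₁ t₂)),
        (W.baseChange (AlgebraicClosure F)).toAffine.addY s₁ t₁ s₂
          ((W.baseChange (AlgebraicClosure F)).toAffine.slope s₁ t₁ s₂
            ((W.baseChange (AlgebraicClosure F)).toAffine.negY t₁ t₂))] := by
    rw [hdiff, hSe, hTe, sub_eq_add_neg, hneg, hadd, xy_some]
  -- values along the chord formula
  have hL := HasValueAt.slope hP hu₁ hv₁ hu₂ (hv₁.negY hv₂) hx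
  have hX := hu₁.addX hv₁ hL
  have hY := hu₁.addY hv₁ hu₂ hL
  rw [hxy]
  refine ⟨?_, ?_⟩
  · rw [hlx]; simpa using hX
  · rw [hly]; simpa using hY

omit [Fintype F] [W.IsElliptic] [DecidableEq F] in
/-- Values of `q̄(f)` for `q ∈ k[X]` from the value of `f`. [folklore] -/
theorem hasValueAt_eval_map {f : W.geomFunctionField} {P : W.geomPoints} {a : AlgebraicClosure F}
    (hf : W.HasValueAt f P a) (q : F[X]) :
    W.HasValueAt ((q.map (algebraMap F W.geomFunctionField)).eval f) P
      ((q.map (algebraMap F (AlgebraicClosure F))).eval a) := by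
  induction q using Polynomial.induction_on' with
  | add p q hp hq => simpa [Polynomial.map_add, eval_add] using hp.add hq
  | monomial n c =>
    simp only [Polynomial.map_monomial, eval_monomial]
    have hc : W.HasValueAt (algebraMap F W.geomFunctionField c) P (algebraMap F (AlgebraicClosure F) c) := by
      rw [IsScalarTower.algebraMap_apply F (AlgebraicClosure F) W.geomFunctionField]
      exact hasValueAt_algebraMap _ P
    exact hc.mul (hf.pow n)

omit [Fintype F] [W.IsElliptic] [DecidableEq F] in
/-- **Values of `p̄(f, g)` for `p ∈ k[X][Y]`** from the values of `f` and `g`. [folklore] -/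
theorem hasValueAt_evalEval_map {f g : W.geomFunctionField} {P : W.geomPoints} {a b : AlgebraicClosure F}
    (hf : W.HasValueAt f P a) (hg : W.HasValueAt g P b) (p : F[X][Y]) :
    W.HasValueAt ((p.map (mapRingHom (algebraMap F W.geomFunctionField))).evalEval f g) P
      ((p.map (mapRingHom (algebraMap F (AlgebraicClosure F)))).evalEval a b) := by
  induction p using Polynomial.induction_on' with
  | add p q hp hq => simpa [Polynomial.map_add, evalEval_add] using hp.add hq
  | monomial n c =>
    rw [← C_mul_X_pow_eq_monomial]
    simp only [Polynomial.map_mul, Polynomial.map_pow, Polynomial.map_C, Polynomial.map_X, coe_mapRingHom,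
      evalEval_mul, evalEval_pow, evalEval_C, evalEval_X]
    exact (hasValueAt_eval_map W hf c).mul (hg.pow n)

include hσ in
/-- **Values of `ι(λ r)` for `r ∈ k[W]`**: `(ι λ r)(P) = r(σP - P)` when `σP ≠ P`.
[cite: SilvermanAEC2009, III.2.3 and II.§2] -/
theorem hasValueAt_toGeom_lam_algebraMap {P : W.geomPoints} (hP : P ≠ 0) (hσP : σ • P ≠ P)
    {a b : AlgebraicClosure F} (h : (W.baseChange (AlgebraicClosure F)).toAffine.Nonsingular a b)
    (he : σ • P - P = .some a b h) (r : W.toAffine.CoordinateRing) :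
    W.HasValueAt (toGeom W (lam W (algebraMap W.toAffine.CoordinateRing W.toAffine.FunctionField r))) P
      (evalBase W h r) := by
  obtain ⟨hx, hy⟩ := hasValueAt_toGeom_lam W σ hσ hP hσP
  rw [he, xy_some] at hx hy
  simp only [Matrix.cons_val_zero, Matrix.cons_val_one] at hx hy
  obtain ⟨p, rfl⟩ := AdjoinRoot.mk_surjective r
  change W.HasValueAt (toGeom W (lam W (algebraMap _ _ (Affine.CoordinateRing.mk W.toAffine p)))) P
    (evalBase W h (Affine.CoordinateRing.mk W.toAffine p))
  rw [WeierstrassFunctionField.algebraMap_mk, map_aevalAeval, map_aevalAeval, aevalAeval_eq_evalEval_map,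
    evalBase_mk]
  exact hasValueAt_evalEval_map W hx hy p

include hσ in
/-- **Places: `λ z` is regular at `P` iff `z` is regular at `σP - P`** (`σP ≠ P`), i.e. the place of
the Lang covering `k(W) ⊇ λ k(W)` below the geometric point `P` lies over the place of `λ k(W) ≅ k(W)`
below `ϖ(P) = σP - P`. [cite: SilvermanAEC2009, II.§2] [cite: KohelShparlinski2000, §2] -/
theorem lam_mem_belowPlace_iff {P : W.geomPoints} (hP : P ≠ 0) (hσP : σ • P ≠ P) (z : W.toAffine.FunctionField) :
    lam W z ∈ (belowPlace W P).toValuationSubring ↔ z ∈ (belowPlace W (σ • P - P)).toValuationSubring := by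
  have hR : σ • P - P ≠ 0 := sub_ne_zero.2 hσP
  obtain ⟨a, b, h, he⟩ := geomPoints.exists_eq_some hR
  -- fractions `n / d`, `d(σP - P) ≠ 0`, go to functions regular at `P`
  have key : ∀ w : W.toAffine.FunctionField, w ∈ (belowPlace W (σ • P - P)).toValuationSubring →
      ∃ c : AlgebraicClosure F, W.HasValueAt (toGeom W (lam W w)) P c ∧
        ((belowPlace W (σ • P - P)).valuation w < 1 → c = 0) := by
    intro w hw
    rw [he, belowPlace_some_eq_ofPrime, PlaceOver.mem_ofPrime_iff] at hw
    obtain ⟨n, d, hnd⟩ := (kerPrime W h).exists_primeCompl_mul_eq_of_integer w hw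
    have hd : evalBase W h (d : W.toAffine.CoordinateRing) ≠ 0 := fun h0 => d.2 ((mem_kerPrime_iff W h _).2 h0)
    have hd0 : algebraMap W.toAffine.CoordinateRing W.toAffine.FunctionField (d : W.toAffine.CoordinateRing) ≠ 0 :=
      fun h0 => hd (by
        have : (d : W.toAffine.CoordinateRing) = 0 := IsFractionRing.injective W.toAffine.CoordinateRing
          W.toAffine.FunctionField (by rw [h0, map_zero])
        rw [this, map_zero])
    have hw' : w = algebraMap _ _ n / algebraMap _ _ (d : W.toAffine.CoordinateRing) := by
      rw [eq_div_iff hd0, hnd]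
    have Vn := hasValueAt_toGeom_lam_algebraMap W σ hσ hP hσP h he n
    have Vd := hasValueAt_toGeom_lam_algebraMap W σ hσ hP hσP h he (d : W.toAffine.CoordinateRing)
    refine ⟨evalBase W h n / evalBase W h d, ?_, fun hlt => ?_⟩
    · rw [hw', map_div₀, map_div₀]
      exact Vn.div hP Vd hd
    · -- `v(w) < 1` forces `n ∈ 𝔭`
      have hn : evalBase W h n = 0 := by
        rw [he, belowPlace_some_eq_ofPrime, valuation_ofPrime_lt_one_iff] at hlt
        have hdle := (kerPrime W h).valuation_le_one (K := W.toAffine.FunctionField) (d : W.toAffine.CoordinateRing)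
        have : (kerPrime W h).valuation W.toAffine.FunctionField (algebraMap _ _ n) < 1 := by
          rw [← hnd, Valuation.map_mul]
          calc _ ≤ (kerPrime W h).valuation W.toAffine.FunctionField w * 1 := by gcongr
            _ < 1 := by rwa [mul_one]
        rw [IsDedekindDomain.HeightOneSpectrum.valuation_lt_one_iff_mem] at this
        exact (mem_kerPrime_iff W h n).1 this
      rw [hn, zero_div]
  constructor
  · intro hz
    by_contra hz'
    have hz0 : z ≠ 0 := by rintro rfl; exact hz' (zero_mem _)
    -- `z⁻¹` lies in the maximal ideal of the place below `σP - P`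
    have hinv : z⁻¹ ∈ (belowPlace W (σ • P - P)).toValuationSubring :=
      ((belowPlace W (σ • P - P)).toValuationSubring.mem_or_inv_mem z).resolve_left hz'
    have hlt : (belowPlace W (σ • P - P)).valuation z⁻¹ < 1 := by
      rw [valuation_lt_one_iff_eq_zero_or]
      exact Or.inr (by rwa [inv_inv])
    obtain ⟨c, hc, hc0⟩ := key z⁻¹ hinv
    rw [hc0 hlt, map_inv₀, map_inv₀] at hc
    -- so `(ι λ z)⁻¹` is a non-unit at `P`, i.e. `ι λ z ∉ k̄[W]_P`
    have hnu := (HasValueAt.mem_place hP hc).2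
    rw [map_zero, sub_zero, ValuationSubring.mem_nonunits_iff_or, inv_inv] at hnu
    rcases hnu with h0 | h0
    · exact (inv_ne_zero ((_root_.map_ne_zero (toGeom W)).2 ((_root_.map_ne_zero (lam W)).2 hz0))) h0
    · exact h0 ((mem_belowPlace_iff W P _).1 hz)
  · intro hz
    obtain ⟨c, hc, -⟩ := key z hz
    exact (mem_belowPlace_iff W P _).2 (HasValueAt.mem_place hP hc).1

end Values

/-! ### Translations: `ι ∘ τ_T = τ_{T̄}^* ∘ ι`, values of translates -/

section Translation

omit [Fintype F] [W.IsElliptic] in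
/-- `ι` of a constant point of `E(k) ⊆ E(k(W))` is the constant point of `E(k̄) ⊆ E(k̄(W))`. [folklore] -/
theorem map_toGeom_constPt (T : W.toAffine.Point) :
    Affine.Point.map (W' := W) (toGeom W) (constPt W T) = W.constPoint (W.toGeomPoints T) := by
  rcases T with _ | ⟨a, b, h⟩
  · change Affine.Point.map (W' := W) (toGeom W) (constPt W 0) = W.constPoint (W.toGeomPoints 0)
    rw [map_zero, map_zero, map_zero, map_zero]
  · change Affine.Point.map (W' := W) (toGeom W) (Affine.Point.map (W' := W) _ (.some a b h)) =
      Affine.Point.map (W' := W) _ (Affine.Point.map (W' := W) _ (.some a b h))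
    rw [Affine.Point.map_some, Affine.Point.map_some, Affine.Point.map_some, Affine.Point.map_some]
    refine some_eq_some W ?_ ?_
    · change toGeom W (algebraMap F _ a) = algebraMap (AlgebraicClosure F) _ (algebraMap F _ a)
      rw [AlgHom.commutes, ← IsScalarTower.algebraMap_apply]
    · change toGeom W (algebraMap F _ b) = algebraMap (AlgebraicClosure F) _ (algebraMap F _ b)
      rw [AlgHom.commutes, ← IsScalarTower.algebraMap_apply]

omit [Fintype F] in
/-- **`ι ∘ τ_T = τ_{T̄}^* ∘ ι`**: the translation by a rational point `T ∈ E(k)` on `k(W)` is the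
restriction of the geometric translation by `T̄ ∈ E(k̄)` on `k̄(W)` (both send `(x, y)` to the
coordinates of `Q + T`). [cite: SilvermanAEC2009, III.4.7 and III.4.10(b)] -/
theorem toGeom_transl (T : W.toAffine.Point) (z : W.toAffine.FunctionField) :
    toGeom W (LangTorsor.transl T z) = W.transAlgHom (W.toGeomPoints T) (toGeom W z) := by
  have hpt : Affine.Point.map (W' := W) (toGeom W) (Affine.Point.map (W' := W) (LangTorsor.transl T) (genPt W)) =
      Affine.Point.map (W' := W) (W.transAlgHom (W.toGeomPoints T))
        (Affine.Point.map (W' := W) (toGeom W) (genPt W)) := by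
    rw [map_transl_genPt, map_add, map_toGeom_genPt, map_toGeom_constPt, ← map_transAlgHom_genericPoint]
  rw [genPt_eq, Affine.Point.map_some, Affine.Point.map_some, Affine.Point.map_some, Affine.Point.map_some] at hpt
  obtain ⟨hx, hy⟩ := Affine.Point.some.inj hpt
  have key : (toGeom W).comp (LangTorsor.transl T) =
      ((W.transAlgHom (W.toGeomPoints T)).restrictScalars F).comp (toGeom W) :=
    algHom_ext_xy hx hy
  exact congrArg (fun f => f z) key

omit [Fintype F] [DecidableEq F] in
/-- **`(τ_T^* z)(P) = z(P + T)`** without the restriction `P ≠ T` of the tree's lemma (`P ≠ O`,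
`P + T ≠ O`): factor `τ_T = τ_B ∘ τ_{T - B}` through a generic auxiliary point `B`.
[cite: SilvermanAEC2009, II.§2 and III.3.6] -/
theorem hasValueAt_transAlgHom {z : W.geomFunctionField} {P T : W.geomPoints} {c : AlgebraicClosure F}
    (hP : P ≠ 0) (hPT' : P + T ≠ 0) (h : W.HasValueAt z (P + T) c) :
    W.HasValueAt (W.transAlgHom T z) P c := by
  by_cases hPT : P ≠ T
  · exact h.transAlgHom hP hPT hPT'
  push Not at hPT
  -- a generic `B`: `B ≠ P, -P` and `2B ≠ T - P`
  obtain ⟨B, hBP, hBP', -, -, hB2⟩ := exists_good_aux W P (P - T - P)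
  have hB2' : P + B ≠ T - B := fun e => hB2 (by
    rw [two_smul]
    have : B + B = T - P := by
      have := congrArg (· + (B - P)) e
      calc B + B = P + B + (B - P) := by abel
        _ = T - B + (B - P) := this
        _ = T - P := by abel
    rw [this]; abel)
  have hPB0 : P + B ≠ 0 := fun e => hBP' (by rw [← sub_eq_zero, sub_neg_eq_add, add_comm]; exact e)
  have e1 : W.transAlgHom T z = W.transAlgHom B (W.transAlgHom (T - B) z) := by
    rw [← AlgHom.comp_apply, ← transAlgHom_add, add_sub_cancel]
  rw [e1]
  refine HasValueAt.transAlgHom hP hBP.symm hPB0 ?_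
  have e2 : P + B + (T - B) = P + T := by abel
  refine HasValueAt.transAlgHom hPB0 hB2' (by rw [e2]; exact hPT') ?_
  rw [e2]; exact h

end Translation

/-! ### Frobenius elements of the Lang covering -/

section LangFrobenius

variable (σ : Field.absoluteGaloisGroup F) (hσ : ∀ x : AlgebraicClosure F, σ • x = x ^ Fintype.card F)

omit [W.IsElliptic] [DecidableEq F] in
include hσ in
/-- `σ x = x^{#k}` in the `Nat.card` normalisation of `WeierstrassGeometricPlaces`. [folklore] -/
theorem hσ_natCard : ∀ x : AlgebraicClosure F, σ • x = x ^ Nat.card F := fun x => by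
  rw [hσ, Nat.card_eq_fintype_card]

omit [Fintype F] [DecidableEq F] in
/-- A value `0` forces valuation `< 1` at the place below. [folklore] -/
theorem valuation_belowPlace_lt_one_of_hasValueAt_zero {P : W.geomPoints} (hP : P ≠ 0) {z : W.toAffine.FunctionField}
    (hz : W.HasValueAt (toGeom W z) P 0) : (belowPlace W P).valuation z < 1 := by
  rw [valuation_belowPlace_lt_one_iff, ← mem_nonunits_place_iff]
  have h := (HasValueAt.mem_place hP hz).2
  rwa [map_zero, sub_zero] at h

omit [Fintype F] [DecidableEq F] in
/-- Valuation `< 1` at the place below forces the value to be `0`. [folklore] -/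
theorem eq_zero_of_valuation_belowPlace_lt_one {P : W.geomPoints} (hP : P ≠ 0) {z : W.toAffine.FunctionField}
    {c : AlgebraicClosure F} (hz : W.HasValueAt (toGeom W z) P c) (hlt : (belowPlace W P).valuation z < 1) : c = 0 := by
  by_contra hc
  rw [valuation_belowPlace_lt_one_iff] at hlt
  have hz0 : toGeom W z ≠ 0 := hz.ne_zero hP hc
  have hord := hz.ord_eq_zero hP hc
  rw [placeValuation_eq_exp_neg_ord _ hz0, hord, neg_zero, WithZero.exp_zero] at hlt
  exact lt_irrefl _ hlt

/-- **The place of the Lang cover `LangCover W` (the field `k(W)`) below a geometric point `P`**: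
`belowPlace W P` regarded as a place of `LangCover W`. [cite: SilvermanAEC2009, II.§2] -/
def coverPlace (P : W.geomPoints) : PlaceOver F (LangCover W) := belowPlace W P

omit [Fintype F] [DecidableEq F] in
/-- Membership in `coverPlace` (definitional). [folklore] -/
theorem mem_coverPlace_iff (P : W.geomPoints) (z : W.toAffine.FunctionField) :
    (LangCover.ofFun W z) ∈ (coverPlace W P).toValuationSubring ↔ z ∈ (belowPlace W P).toValuationSubring :=
  Iff.rfl

include hσ in
/-- **`coverPlace P` lies over the place of `k(W)` below `ϖ(P) = σP - P`** along `λ` (`σP ≠ P`).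
[cite: SilvermanAEC2009, II.§2] [cite: KohelShparlinski2000, §2] -/
theorem coverPlace_liesOver {P : W.geomPoints} (hP : P ≠ 0) (hσP : σ • P ≠ P) :
    ∀ z : W.toAffine.FunctionField, algebraMap W.toAffine.FunctionField (LangCover W) z ∈
      (coverPlace W P).toValuationSubring ↔ z ∈ (belowPlace W (σ • P - P)).toValuationSubring :=
  fun z => by
    rw [LangCover.algebraMap_apply]
    exact (mem_coverPlace_iff W P (lam W z)).trans (lam_mem_belowPlace_iff W σ hσ hP hσP z)

omit [DecidableEq F] in
include hσ in
/-- **The Frobenius translation point**: there is `T ∈ E(k)` with `T̄ = σ^d P - P`, where `d` is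
the degree of the place of `k(W)` below `σP - P` (the point `σ^d P - P` is `σ`-invariant because
`σ^d` fixes `σP - P`). [cite: SilvermanAEC2009, II.§2] [cite: KohelShparlinski2000, §2] -/
theorem exists_frobPoint {P : W.geomPoints} (hσP : σ • P ≠ P) :
    ∃ T : W.toAffine.Point,
      W.toGeomPoints T = (σ ^ (belowPlace W (σ • P - P)).degree) • P - P := by
  set d := (belowPlace W (σ • P - P)).degree with hd
  have hR : σ • P - P ≠ 0 := sub_ne_zero.2 hσP
  obtain ⟨a, b, h, he⟩ := geomPoints.exists_eq_some hR
  have hfixR : (σ ^ d) • (σ • P - P) = σ • P - P := by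
    have := pow_degree_smul_eq W σ (hσ_natCard σ hσ) h
    rw [← he] at this
    convert this using 2
  have hfix : σ • ((σ ^ d) • P - P) = (σ ^ d) • P - P := by
    have hcomm : σ • (σ ^ d) • P = (σ ^ d) • σ • P := by
      rw [← mul_smul, ← mul_smul, ← pow_succ', ← pow_succ]
    rw [smul_sub] at hfixR
    rw [smul_sub, hcomm]
    calc (σ ^ d) • σ • P - σ • P
        = ((σ ^ d) • σ • P - (σ ^ d) • P) - (σ • P - P) + ((σ ^ d) • P - P) := by abel
      _ = (σ ^ d) • P - P := by rw [hfixR, sub_self, zero_add]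
  obtain ⟨T, hT⟩ := mem_range_toGeomPoints_of_smul_eq (hσ_natCard σ hσ) hfix
  exact ⟨T, hT⟩

/-- **The Frobenius translation point `T_P ∈ E(k)`** (`T̄_P = σ^d P - P`). [cite: KohelShparlinski2000, §2] -/
def frobPoint {P : W.geomPoints} (hσP : σ • P ≠ P) : W.toAffine.Point :=
  (exists_frobPoint W σ hσ hσP).choose

omit [DecidableEq F] in
/-- `T̄_P = σ^d P - P`. [cite: KohelShparlinski2000, §2] -/
theorem toGeomPoints_frobPoint {P : W.geomPoints} (hσP : σ • P ≠ P) :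
    W.toGeomPoints (frobPoint W σ hσ hσP) = (σ ^ (belowPlace W (σ • P - P)).degree) • P - P :=
  (exists_frobPoint W σ hσ hσP).choose_spec

omit [Fintype F] in
/-- **Translations move the places below geometric points by the translation point**:
`τ_T z` is regular at `P` iff `z` is regular at `P + T̄`. [cite: SilvermanAEC2009, II.§2] -/
theorem transl_mem_belowPlace_iff (T : W.toAffine.Point) (P : W.geomPoints) (z : W.toAffine.FunctionField) :
    LangTorsor.transl T z ∈ (belowPlace W P).toValuationSubring ↔
      z ∈ (belowPlace W (P + W.toGeomPoints T)).toValuationSubring := by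
  rw [mem_belowPlace_iff, mem_belowPlace_iff, toGeom_transl, mem_place_iff, mem_place_iff,
    placeValuation_transAlgHom]

/-- **`τ_{T_P}` fixes the place `coverPlace P`** (`P + T̄_P = σ^d P` lies over the same place).
[cite: SilvermanAEC2009, II.§2] -/
theorem comapRingEquiv_transl_frobPoint {P : W.geomPoints} (hσP : σ • P ≠ P) :
    (coverPlace W P).comapRingEquiv
      (LangCover.transl W (frobPoint W σ hσ hσP) : LangCover W ≃+* LangCover W) = coverPlace W P := by
  refine PlaceOver.eq_of_le fun z hz => ?_
  rw [PlaceOver.mem_comapRingEquiv_iff] at hz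
  change LangTorsor.transl (frobPoint W σ hσ hσP) z ∈ (belowPlace W P).toValuationSubring at hz
  rw [transl_mem_belowPlace_iff, toGeomPoints_frobPoint, add_sub_cancel, belowPlace_smul] at hz
  exact hz

/-- **A translation congruent to the identity modulo the place below `P ≠ O` is trivial**:
`τ_{T'}` fixing `coverPlace P` with `τ_{T'} y ≡ y` for all `y` regular at `P` has `x(P + T̄') = x(P)`
and `y(P + T̄') = y(P)`, so `T̄' = O`. [cite: SilvermanAEC2009, III.4.10(b) and II.§2] -/
theorem transl_eq_zero_of_forall {P : W.geomPoints} (hP : P ≠ 0) {T' : W.toAffine.Point}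
    (hθQ : (coverPlace W P).comapRingEquiv
      (LangCover.transl W T' : LangCover W ≃+* LangCover W) = coverPlace W P)
    (hθ1 : ∀ y ∈ (coverPlace W P).toValuationSubring,
      (coverPlace W P).valuation (LangCover.transl W T' y - y) < 1) : T' = 0 := by
  set T := W.toGeomPoints T' with hT
  -- `x` is regular at `P`, hence so is `τ_{T'} x`; this rules out `P + T̄' = O`
  have hx : xF W.toAffine ∈ (belowPlace W P).toValuationSubring := xF_mem_belowPlace W hP
  have hθx : LangTorsor.transl T' (xF W.toAffine) ∈ (belowPlace W P).toValuationSubring :=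
    PlaceOver.apply_mem_of_comapRingEquiv_eq hθQ (y := LangCover.ofFun W (xF W.toAffine)) hx
  rw [transl_mem_belowPlace_iff] at hθx
  have hPT : P + T ≠ 0 := by
    intro h0
    rw [h0, mem_belowPlace_iff, toGeom_xF, place_zero] at hθx
    exact WeierstrassPlaceAtInfinity.x_not_mem_infPlace _ hθx
  -- the coordinates of `P + T̄'` and `P` agree
  have key : ∀ i : Fin 2, xy (P + T) i = xy P i := by
    intro i
    set zi : W.toAffine.FunctionField := ![xF W.toAffine, yF W.toAffine] i with hzi_def
    have hzi : toGeom W zi = ![W.genX, W.genY] i := by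
      fin_cases i
      · exact toGeom_xF W
      · exact toGeom_yF W
    have hzi_mem : zi ∈ (belowPlace W P).toValuationSubring := by
      obtain ⟨a, b, hab, rfl⟩ := geomPoints.exists_eq_some hP
      fin_cases i
      · exact xF_mem_belowPlace W hP
      · exact algebraMap_mem_belowPlace W hab _
    have hτ : W.HasValueAt (toGeom W (LangTorsor.transl T' zi)) P (xy (P + T) i) := by
      rw [toGeom_transl, hzi]
      exact hasValueAt_transAlgHom W hP hPT (hasValueAt_gen _ i)
    have hP' : W.HasValueAt (toGeom W zi) P (xy P i) := by
      rw [hzi]; exact hasValueAt_gen _ i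
    have hlt := hθ1 (LangCover.ofFun W zi) hzi_mem
    change (belowPlace W P).valuation (LangTorsor.transl T' zi - zi) < 1 at hlt
    have hdiff : W.HasValueAt (toGeom W (LangTorsor.transl T' zi - zi)) P (xy (P + T) i - xy P i) := by
      rw [map_sub]; exact hτ.sub hP'
    exact sub_eq_zero.1 (eq_zero_of_valuation_belowPlace_lt_one W hP hdiff hlt)
  have hPT' : P + T = P := geomPoints.eq_of_xy_eq hPT hP (funext key)
  have hT0 : T = 0 := add_eq_left.1 hPT'
  exact W.toGeomPoints_injective (by rw [← hT, hT0, map_zero])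

set_option synthInstance.maxHeartbeats 400000 in
include hσ in
/-- **The inertia group of the Lang covering at `coverPlace P` is trivial** (`P ≠ O`, `σP ≠ P`).
[cite: SilvermanAEC2009, III.4.10(b) and II.§2] -/
theorem inertia_coverPlace_eq_bot {P : W.geomPoints} (hP : P ≠ 0) (hσP : σ • P ≠ P) :
    (PlaceOver.primeBelow (coverPlace W P) (coverPlace_liesOver W σ hσ hP hσP)).inertia
      (LangCover W ≃ₐ[W.toAffine.FunctionField] LangCover W) = ⊥ := by
  refine PlaceOver.inertia_eq_bot_of_forall _ _ fun θ hθQ hθ1 => ?_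
  -- `θ = τ_{T'}`
  obtain ⟨T', rfl⟩ : ∃ T' : W.toAffine.Point, LangCover.transl W T' = θ :=
    ⟨Multiplicative.toAdd ((LangCover.translMulEquiv W).symm θ), by
      rw [← LangCover.translAutHom_ofAdd, ofAdd_toAdd, ← LangCover.translMulEquiv_apply, MulEquiv.apply_symm_apply]⟩
  rw [transl_eq_zero_of_forall W hP hθQ hθ1, LangCover.transl_zero]

set_option synthInstance.maxHeartbeats 400000 in
include hσ in
/-- **The Frobenius element of the Lang covering at the place below `P` is the translation by
`T_P`, `T̄_P = σ^d P - P`** (`d` the degree of the place of `k(W)` below `ϖ(P) = σP - P`): for `z`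
regular at `P` with value `c`, `τ_{T_P} z` has the value `z(σ^d P) = σ^d c = c^{q^d}` at `P`, which is
also the value of `z^{q^d}`; and `q^d = #κ(v)`. This is the function-field form of "the Artin symbol
of the Lang torsor at `v` is the Frobenius-orbit sum (trace) of the fibre" (Lang's theorem).
[cite: SilvermanAEC2009, II.§2 and III.4.10(b)] [cite: KohelShparlinski2000, §2] -/
theorem frob_coverPlace {P : W.geomPoints} (hP : P ≠ 0) (hσP : σ • P ≠ P) :
    PlaceOver.frob (coverPlace W P) (coverPlace_liesOver W σ hσ hP hσP) =
      LangCover.transl W (frobPoint W σ hσ hσP) := by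
  symm
  refine PlaceOver.eq_frob_of_forall _ _ (inertia_coverPlace_eq_bot W σ hσ hP hσP)
    (comapRingEquiv_transl_frobPoint W σ hσ hσP) fun y hy => ?_
  set d := (belowPlace W (σ • P - P)).degree with hd
  obtain ⟨y, rfl⟩ : ∃ y' : W.toAffine.FunctionField, LangCover.ofFun W y' = y := ⟨(LangCover.ofFun W).symm y, rfl⟩
  change (belowPlace W P).valuation (LangTorsor.transl (frobPoint W σ hσ hσP) y -
    y ^ Nat.card (belowPlace W (σ • P - P)).residueField) < 1
  rw [PlaceOver.natCard_residueField, ← hd]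
  obtain ⟨c, hc⟩ := exists_hasValueAt_of_mem_place hP ((mem_belowPlace_iff W P y).1 hy)
  have hPT : P + W.toGeomPoints (frobPoint W σ hσ hσP) = (σ ^ d) • P := by
    rw [toGeomPoints_frobPoint, add_sub_cancel]
  have h1 : W.HasValueAt (toGeom W (LangTorsor.transl (frobPoint W σ hσ hσP) y)) P ((σ ^ d) • c) := by
    rw [toGeom_transl]
    refine hasValueAt_transAlgHom W hP (by rw [hPT]; exact smul_ne_zero_of_ne_zero W _ hP) ?_
    rw [hPT]; exact WeierstrassGeometricPlaces.HasValueAt.toGeom_smul W hc (σ ^ d)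
  have h2 : W.HasValueAt (toGeom W (y ^ Nat.card F ^ d)) P ((σ ^ d) • c) := by
    rw [map_pow, pow_smul_eq_pow_pow σ (hσ_natCard σ hσ) d c]; exact hc.pow _
  have h := h1.sub h2
  rw [sub_self, ← map_sub] at h
  exact valuation_belowPlace_lt_one_of_hasValueAt_zero W hP h

end LangFrobenius

/-! ### The Lang–Artin map `v ↦ T_v ∈ E(k)` and its reciprocity law -/

section LangArtinMap

variable (σ : Field.absoluteGaloisGroup F) (hσ : ∀ x : AlgebraicClosure F, σ • x = x ^ Fintype.card F)

omit [Fintype F] [W.IsElliptic] [DecidableEq F] in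
/-- Telescoping: `σ^d P - P = Σ_{j<d} σ^j (σP - P)`. [folklore] -/
theorem pow_smul_sub_eq_sum (d : ℕ) (P : W.geomPoints) :
    (σ ^ d) • P - P = ∑ j ∈ Finset.range d, (σ ^ j) • (σ • P - P) := by
  induction d with
  | zero => simp
  | succ d ih =>
    rw [Finset.sum_range_succ, ← ih, smul_sub, ← mul_smul, ← pow_succ]
    abel

omit [DecidableEq F] in
include hσ in
/-- **`T̄_P = Σ_{j < d} σ^j (σP - P)`**: the Frobenius translation point is the orbit sum (trace down
to `k`) of `ϖ(P) = σP - P`. [cite: KohelShparlinski2000, §2] -/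
theorem toGeomPoints_frobPoint_eq_orbitSum {P : W.geomPoints} (hσP : σ • P ≠ P) :
    W.toGeomPoints (frobPoint W σ hσ hσP) = orbitSum W σ (σ • P - P) := by
  rw [toGeomPoints_frobPoint, orbitSum, pow_smul_sub_eq_sum]

omit [DecidableEq F] in
include hσ in
/-- The orbit sum of an affine point is `σ`-invariant. [cite: Stichtenoth2009, Thm. 3.6.3] -/
theorem smul_orbitSum {R : W.geomPoints} (hR : R ≠ 0) : σ • orbitSum W σ R = orbitSum W σ R := by
  obtain ⟨a, b, h, rfl⟩ := geomPoints.exists_eq_some hR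
  set d := (belowPlace W (.some a b h)).degree with hd
  set f : ℕ → W.geomPoints := fun j => (σ ^ j) • (show W.geomPoints from .some a b h) with hf
  have hper : f d = f 0 := by
    simp only [hf, pow_zero, one_smul]
    exact pow_degree_smul_eq W σ (hσ_natCard σ hσ) h
  have h1 := Finset.sum_range_succ f d
  have h2 := Finset.sum_range_succ' f d
  rw [hper, h2, add_left_inj] at h1
  -- `h1 : Σ_{j<d} f j = Σ_{j<d} f (j+1)`
  rw [orbitSum, ← hd]
  change σ • ∑ j ∈ Finset.range d, f j = ∑ j ∈ Finset.range d, f j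
  conv_rhs => rw [← h1]
  rw [Finset.smul_sum]
  refine Finset.sum_congr rfl fun j _ => ?_
  simp only [hf]
  rw [← mul_smul, ← pow_succ']

omit [DecidableEq F] in
include hσ in
/-- `orbitSum (σ R) = orbitSum R` (`R` affine). [cite: Stichtenoth2009, Thm. 3.6.3] -/
theorem orbitSum_smul {R : W.geomPoints} (hR : R ≠ 0) : orbitSum W σ (σ • R) = orbitSum W σ R := by
  conv_rhs => rw [← smul_orbitSum W σ hσ hR]
  rw [orbitSum, orbitSum, belowPlace_smul, Finset.smul_sum]
  refine Finset.sum_congr rfl fun j _ => ?_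
  rw [← mul_smul, ← mul_smul, ← pow_succ, ← pow_succ']

omit [DecidableEq F] in
include hσ in
/-- `orbitSum (σ^i R) = orbitSum R` (`R` affine). [cite: Stichtenoth2009, Thm. 3.6.3] -/
theorem orbitSum_pow_smul {R : W.geomPoints} (hR : R ≠ 0) (i : ℕ) :
    orbitSum W σ ((σ ^ i) • R) = orbitSum W σ R := by
  induction i with
  | zero => rw [pow_zero, one_smul]
  | succ i ih =>
    rw [pow_succ', mul_smul, orbitSum_smul W σ hσ (smul_ne_zero_of_ne_zero W _ hR), ih]

omit [DecidableEq F] in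
include hσ in
/-- **Points over the same place have the same orbit sum.** [cite: Stichtenoth2009, Thm. 3.6.3] -/
theorem orbitSum_eq_of_belowPlace_eq {R R' : W.geomPoints} (hR : R ≠ 0)
    (h : belowPlace W R' = belowPlace W R) : orbitSum W σ R' = orbitSum W σ R := by
  obtain ⟨a, b, hab, rfl⟩ := geomPoints.exists_eq_some hR
  obtain ⟨j, -, rfl⟩ := exists_eq_pow_smul W σ (hσ_natCard σ hσ) hab h
  exact orbitSum_pow_smul W σ hσ hR j

omit [Fintype F] [W.IsElliptic] in
/-- `E(k) → E(k̄)` is additive (for the group law computed with any decidability instance on `k`).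
[folklore] -/
theorem toGeomPoints_add (T T' : W.toAffine.Point) :
    W.toGeomPoints (T + T') = W.toGeomPoints T + W.toGeomPoints T' := by
  have h : (‹DecidableEq F› : DecidableEq F) = Classical.decEq F := Subsingleton.elim _ _
  subst h
  exact toGeomPoints_add_classical W T T'

omit [Fintype F] [W.IsElliptic] in
/-- `E(k) → E(k̄)` as an additive homomorphism for the group law computed with the given
decidability instance on `k` (the tree's `toGeomPoints` is stated for the classical one). [folklore] -/
def toGeomPointsHom : W.toAffine.Point →+ W.geomPoints where
  toFun := W.toGeomPoints
  map_zero' := map_zero _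
  map_add' := toGeomPoints_add W

omit [Fintype F] [W.IsElliptic] in
/-- `toGeomPointsHom` is `toGeomPoints` (definitional). [folklore] -/
@[simp] theorem toGeomPointsHom_apply (T : W.toAffine.Point) : toGeomPointsHom W T = W.toGeomPoints T := rfl

omit [DecidableEq F] in
include hσ in
/-- Existence of the Lang–Artin point of a place. [cite: KohelShparlinski2000, §2] -/
theorem exists_langPt (v : PlaceOver F W.toAffine.FunctionField) :
    ∃ T : W.toAffine.Point, ∀ R : W.geomPoints, R ≠ 0 → belowPlace W R = v →
      W.toGeomPoints T = orbitSum W σ R := by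
  by_cases hv : v = WeierstrassPlaceAtInfinity.infPlace W.toAffine
  · exact ⟨0, fun R hR hRv => absurd (hRv.trans hv) (belowPlace_ne_infPlace W hR)⟩
  · obtain ⟨R₀, hR₀⟩ := exists_belowPlace_eq W v
    have hR₀0 : R₀ ≠ 0 := fun h0 => hv (by rw [← hR₀, h0, belowPlace_zero])
    obtain ⟨T, hT⟩ := mem_range_toGeomPoints_of_smul_eq (hσ_natCard σ hσ) (smul_orbitSum W σ hσ hR₀0)
    refine ⟨T, fun R hR hRv => ?_⟩
    rw [hT]
    exact (orbitSum_eq_of_belowPlace_eq W σ hσ hR₀0 (hRv.trans hR₀.symm)).symm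

/-- **The Lang–Artin point `T_v ∈ E(k)` of a place `v` of `k(W)`**: the `k`-rational point whose
image in `E(k̄)` is the orbit sum `Σ_{j<deg v} σ^j R` of any geometric point `R` above `v` (the
trace to `k` of the closed point `v`); `T_∞ = O`. By `frob_coverPlace_eq_transl_langPt` it is the
Frobenius element of the Lang covering at the places above `v`. [cite: KohelShparlinski2000, §2]
[cite: SilvermanAEC2009, II.§2 and III.4.10(b)] -/
def langPt (v : PlaceOver F W.toAffine.FunctionField) : W.toAffine.Point :=
  if v = WeierstrassPlaceAtInfinity.infPlace W.toAffine then 0 else (exists_langPt W σ hσ v).choose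

omit [DecidableEq F] in
/-- `T_∞ = O`. [folklore] -/
theorem langPt_infPlace : langPt W σ hσ (WeierstrassPlaceAtInfinity.infPlace W.toAffine) = 0 := by
  rw [langPt, if_pos rfl]

omit [DecidableEq F] in
/-- **`T̄_v = Σ_{j<deg v} σ^j R`** for every geometric point `R` above `v`. [cite: KohelShparlinski2000, §2] -/
theorem toGeomPoints_langPt {v : PlaceOver F W.toAffine.FunctionField} {R : W.geomPoints} (hR : R ≠ 0)
    (hRv : belowPlace W R = v) : W.toGeomPoints (langPt W σ hσ v) = orbitSum W σ R := by
  have hv : v ≠ WeierstrassPlaceAtInfinity.infPlace W.toAffine := fun h => belowPlace_ne_infPlace W hR (hRv.trans h)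
  rw [langPt, if_neg hv]
  exact (exists_langPt W σ hσ v).choose_spec R hR hRv

include hσ in
/-- **The Frobenius element of the Lang covering at the place below `P` is `τ_{T_v}`**, `v` the place
of `k(W)` below `ϖ(P) = σP - P` (`P ≠ O`, `σP ≠ P`). [cite: KohelShparlinski2000, §2]
[cite: SilvermanAEC2009, III.4.10(b)] -/
theorem frob_coverPlace_eq_transl_langPt {P : W.geomPoints} (hP : P ≠ 0) (hσP : σ • P ≠ P) :
    PlaceOver.frob (coverPlace W P) (coverPlace_liesOver W σ hσ hP hσP) =
      LangCover.transl W (langPt W σ hσ (belowPlace W (σ • P - P))) := by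
  rw [frob_coverPlace W σ hσ hP hσP]
  congr 1
  apply W.toGeomPoints_injective
  rw [toGeomPoints_frobPoint_eq_orbitSum, toGeomPoints_langPt W σ hσ (sub_ne_zero.2 hσP) rfl]

include hσ in
/-- **Lang reciprocity: `Σ_v ord_v(h) • T_v = O` in `E(k)`** for `h ∈ k(W)^×` and any finite set `S`
of places containing the finite places where `h` has a zero or a pole — Abel's theorem over `k`
(`sum_ord_smul_orbitSum_eq_zero`) read through `T̄_v = Σ_j σ^j R_v`. This is the reciprocity law of
the (everywhere unramified) Lang covering. [cite: SilvermanAEC2009, Cor. III.3.5 and III.4.10(b)]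
[cite: KohelShparlinski2000, §2] -/
theorem sum_ord_smul_langPt_eq_zero {h : W.toAffine.FunctionField} (hh : h ≠ 0)
    (S : Finset (PlaceOver F W.toAffine.FunctionField))
    (hS : ∀ v : PlaceOver F W.toAffine.FunctionField,
      v ≠ WeierstrassPlaceAtInfinity.infPlace W.toAffine → v.ord h ≠ 0 → v ∈ S) :
    ∑ v ∈ S, v.ord h • langPt W σ hσ v = 0 := by
  apply W.toGeomPoints_injective
  rw [← toGeomPointsHom_apply, map_sum, map_zero]
  simp only [map_zsmul, toGeomPointsHom_apply]
  -- chosen points above the finite places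
  have hex : ∀ v : PlaceOver F W.toAffine.FunctionField, ∃ R : W.geomPoints, belowPlace W R = v :=
    exists_belowPlace_eq W
  set pt : PlaceOver F W.toAffine.FunctionField → W.geomPoints := fun v => (hex v).choose with hpt
  have hptv : ∀ v, belowPlace W (pt v) = v := fun v => (hex v).choose_spec
  set S' := S.filter (· ≠ WeierstrassPlaceAtInfinity.infPlace W.toAffine) with hS'
  have hpt0 : ∀ v ∈ S', pt v ≠ 0 ∧ belowPlace W (pt v) = v := fun v hv => by
    refine ⟨fun h0 => ?_, hptv v⟩
    have := hptv v
    rw [h0, belowPlace_zero] at this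
    exact ((Finset.mem_filter.1 hv).2) this.symm
  have habel := sum_ord_smul_orbitSum_eq_zero W σ (hσ_natCard σ hσ) hh S' pt hpt0 (fun v hv hv' =>
    Finset.mem_filter.2 ⟨hS v hv hv', hv⟩)
  rw [← habel, hS', Finset.sum_filter]
  refine Finset.sum_congr rfl fun v _ => ?_
  split_ifs with hv
  · rw [toGeomPoints_langPt W σ hσ (hpt0 v (Finset.mem_filter.2 ⟨‹_›, hv⟩)).1 (hptv v)]
  · push Not at hv
    rw [hv, langPt_infPlace, map_zero, smul_zero]

end LangArtinMap

end Literature.NumberTheory.EllipticCurves.LangTorsorGeometric
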